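import Mathlib
import Summits.KontsevichZagierPeriods.Zeta5Search.Families.GapRegimePhi
import HarnessLib

/-!
# ζ(5) search — Families: GAUGE INVARIANCE of dual gap constant terms — the exchange identity in `Frac ℤ[g]`

HONEST FRAMING: systematic search; no irrationality claim unless certified.  Cell `pub-zeta5`, seat P2 g10 (Families
layer), 2026-08-23.  An identity between coefficients of integer polynomials; nothing about any zeta value; no record
moves; no conjecture node is used.

SETTING.  `M + 3` points on a circle in the cyclic order `0, 1, …, M+2` (the DUAL seating of a cellular integrand);
chord multiplicities `A u v ≥ 0` (`u < v`) and side multiplicities `B u ≥ 0` on the sides `{u, u+1}`.  A GAUGE sends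
one point to infinity; the remaining `M + 2` points span `M + 1` consecutive gaps `g₀, …, g_M`, every chord not through
`∞` becomes the sum of the gaps it spans, and the DUAL CONSTANT TERM of the gauge is the coefficient of
`∏ g_t^{B(side t)}` in the product of these spans (`GapRegime.endProd`, `GapRegime.gapVec`; P2 g6
`Families/DualConstantTerm`, cert-2 g10 `Families/CubicalChartVIM`, P2 g9 `Families/VIMTorusPeriodCoeff` are three
instances).
* TOP gauge: point `0` at infinity, finite points `1 < 2 < ⋯ < M+2`, gap `t` = side `{t+1, t+2}`;
* BOTTOM gauge: point `M+2` at infinity, finite points `0 < 1 < ⋯ < M+1`, gap `s` = side `{s, s+1}`.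

THEOREM (`GapRegime.gauge_move`).  If the multiplicities are BALANCED at every point finite in both gauges
(`Σ_{v} A{u,v} = B(u−1) + B u` for `1 ≤ u ≤ M+1`), the two dual constant terms are EQUAL:
`[∏_t g_t^{B(t+1)}] endProd (A (·+1) (·+1)) = [∏_s g_s^{B s}] endProd A`.
Iterating the move around the circle: the dual constant term of a balanced configuration does not depend on the
gauge (`Families/VIMGaugeInvariance` does the four moves `∞ = 10 → 2 → 4 → 1 → 6` of Brown's VIM plan).

PROOF (elementary; no series, no analysis).  Write the top positions as suffix sums `y_{t+1} = T_t = g_t + ⋯ + g_M`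
(`y_{M+2} = 0`) inside `K = Frac ℤ[g]`; the bottom gauge is the Möbius image `z = −1/y`: `z_0 = 0`,
`z_{t+1} = −1/T_t`, with gaps `h_0 = 1/T_0`, `h_{t+1} = g_t/(T_t T_{t+1})` and chord spans
`z_u − z_v = (y_u − y_v)·w_u·w_v`, `w = 1/y` (`w_0 = w_{M+2} = 1`).  Balance makes the vertex weights cancel, so
`endProd_top(g) · ∏ h^{B_bot} = endProd_bot(h(g)) · g^{B_top}` EXACTLY in `K` (`ι_top_mul_eq`).  Expanding
`endProd_bot = Σ_d c_d h^d` and clearing denominators gives a POLYNOMIAL identity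
`endProd_top · g^{a} · ∏ T^N = Σ_d c_d g^{B_top + a(d)} ∏ T^{N − c(d) + c(B_bot)}`; applying the regime functional
`Phi N (B_top + a)` (`Families/GapRegimePhi`: `Phi_mul_prod_T_pow`, `Phi_mul_monomial`, `Phi_zero_eq_coeff`) turns the
left side into the top coefficient and each right summand into `c_d · E(a(d−B_bot), c(d−B_bot)) = c_d · [d = B_bot]`
(`GapRegime.E_star`), i.e. into the bottom coefficient.
THIS FILE: the exchange identity `ι_top_mul_eq` and its ingredients (`factor_relation` = the Möbius weights,
`prod_top_chords`, `prod_bot_chords`, `prod_top_sides`, `prod_bot_sides`, `deg_sides`); the polynomial identity and the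
theorem `gauge_move` are in `Families/GapGaugeMove`.  Standard axioms only.
-/

namespace Summit.KontsevichZagierPeriods.Zeta5Search.Families.Cellular

namespace GapRegime

open MvPolynomial Finset

variable {M : ℕ}

/-! ## The exchange identity in `K` -/

section Exchange

variable {K : Type*} [Field K] (ι : MvPolynomial (Fin (M + 1)) ℤ →+* K) (hι : Function.Injective ι)
  (y z : ℕ → K) (h : Fin (M + 1) → K)
  (hy : ∀ k, y k = ι (spanPoly M k (M + 1)))
  (hz0 : z 0 = 0) (hz : ∀ t : Fin (M + 1), z (t.val + 1) = -(y t.val)⁻¹)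
  (hh : ∀ s : Fin (M + 1), h s = z s.val - z (s.val + 1))

include hy hι hz0 hz in
/-- **Möbius weights**: every bottom factor is the top factor times the weights of its endpoints
(`w_u = 1/y_{u−1}` for the points finite in both gauges, `w_0 = w_{M+2} = 1`). -/
theorem factor_relation (u v : ℕ) (huv : u < v) (hv : v < M + 3) :
    (if v = M + 2 then (1 : K) else z u - z v) =
      (if u = 0 then 1 else y (u - 1) - y (v - 1)) *
        (if u = 0 ∨ u = M + 2 then 1 else (y (u - 1))⁻¹) * (if v = 0 ∨ v = M + 2 then 1 else (y (v - 1))⁻¹) := by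
  have hyne : ∀ k, k < M + 1 → y k ≠ 0 := fun k hk => y_ne_zero ι hι y hy ⟨k, hk⟩
  have hzk : ∀ k, 1 ≤ k → k ≤ M + 1 → z k = -(y (k - 1))⁻¹ := by
    intro k hk1 hk2
    have e := hz ⟨k - 1, by omega⟩
    have hk : k - 1 + 1 = k := by omega
    simp only [hk] at e
    exact e
  have hv0 : ¬ (v = 0 ∨ v = M + 2) ↔ v ≠ M + 2 := by omega
  by_cases hu : u = 0
  · subst hu
    have e1 : (if (0 : ℕ) = 0 then (1 : K) else y (0 - 1) - y (v - 1)) = 1 :=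
      if_pos rfl
    have e2 : (if (0 : ℕ) = 0 ∨ 0 = M + 2 then (1 : K) else (y (0 - 1))⁻¹)
      = 1 := if_pos (Or.inl rfl)
    rw [e1, e2, one_mul, one_mul, hz0, zero_sub]
    by_cases hvM : v = M + 2
    · rw [if_pos hvM, if_pos (Or.inr hvM)]
    · rw [if_neg hvM, if_neg (show ¬ (v = 0 ∨ v = M + 2) by omega), hzk v (by omega) (by omega), neg_neg]
  · have e1 : (if u = 0 then (1 : K) else y (u - 1) - y (v - 1)) =
        y (u - 1) - y (v - 1) := if_neg hu
    have e2 : (if u = 0 ∨ u = M + 2 then (1 : K) else (y (u - 1))⁻¹) =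
        (y (u - 1))⁻¹ := if_neg (by omega)
    rw [e1, e2]
    have hu' := hyne (u - 1) (by omega)
    by_cases hvM : v = M + 2
    · rw [if_pos hvM, if_pos (Or.inr hvM), mul_one, hvM, show M + 2 - 1 = M + 1 from rfl, y_anchor ι y hy, sub_zero,
        mul_inv_cancel₀ hu']
    · rw [if_neg hvM, if_neg (show ¬ (v = 0 ∨ v = M + 2) by omega), hzk u (by omega) (by omega),
        hzk v (by omega) (by omega)]
      have hv' := hyne (v - 1) (by omega)
      field_simp
      ring

include hy in
/-- Top chords: `∏_{u<v} tfac^{A} = ι (endProd (A (·+1) (·+1)))`. -/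
theorem prod_top_chords (A : ℕ → ℕ → ℕ) :
    (∏ u ∈ range (M + 3), ∏ v ∈ range (M + 3),
        if u < v then (if u = 0 then 1 else y (u - 1) - y (v - 1)) ^ A u v else 1) =
      ι (endProd M fun i j => A (i + 1) (j + 1)) := by
  rw [Finset.prod_range_succ', endProd, map_prod]
  have h0 : (∏ v ∈ range (M + 3), if 0 < v then
      ((if (0 : ℕ) = 0 then 1 else y (0 - 1) - y (v - 1)) : K) ^ A 0 v
      else 1) = 1 := Finset.prod_eq_one fun v _ => by rw [if_pos rfl]; split_ifs <;> simp
  rw [h0, mul_one]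
  refine Finset.prod_congr rfl fun i hi => ?_
  rw [Finset.prod_range_succ', map_prod, if_neg (Nat.not_lt_zero _), mul_one]
  refine Finset.prod_congr rfl fun j hj => ?_
  rw [Finset.mem_range] at hi hj
  by_cases hij : i < j
  · rw [if_pos (by omega), if_pos hij, if_neg (by omega), map_pow, ι_spanPoly ι y hy i j hij.le (by omega)]
    simp
  · rw [if_neg (by omega), if_neg hij, map_one]

include hh in
/-- Bottom chords: `∏_{u<v} bfac^{A} = aeval h (endProd A)`. -/
theorem prod_bot_chords (A : ℕ → ℕ → ℕ) :
    (∏ u ∈ range (M + 3), ∏ v ∈ range (M + 3),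
        if u < v then (if v = M + 2 then 1 else z u - z v) ^ A u v else 1) =
      MvPolynomial.aeval h (endProd M A) := by
  rw [Finset.prod_range_succ, endProd, map_prod]
  have hlast : (∏ v ∈ range (M + 3), if M + 2 < v then
      ((if v = M + 2 then 1 else z (M + 2) - z v) : K) ^ A (M + 2) v
      else 1) = 1 := Finset.prod_eq_one fun v hv => by rw [Finset.mem_range] at hv; rw [if_neg (by omega)]
  rw [hlast, mul_one]
  refine Finset.prod_congr rfl fun u hu => ?_
  rw [Finset.prod_range_succ, map_prod, if_pos rfl, one_pow]
  have : (if u < M + 2 then (1 : K) else 1) = 1 := by split_ifs <;> rfl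
  rw [this, mul_one]
  refine Finset.prod_congr rfl fun v hv => ?_
  rw [Finset.mem_range] at hu hv
  by_cases huv : u < v
  · rw [if_pos huv, if_pos huv, if_neg (by omega), map_pow, aeval_spanPoly z h hh u v huv.le (by omega)]
  · rw [if_neg huv, if_neg huv, map_one]

/-- A pair-exponent system supported on the sides `{u, u+1}` collapses the inner product. -/
theorem prod_sides_inner {S : Type*} [CommMonoid S] (f : ℕ → ℕ → S) (B : ℕ → ℕ) (n u : ℕ) :
    (∏ v ∈ range n, if u < v then f u v ^ (if v = u + 1 then B u else 0) else 1) =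
      if u + 1 < n then f u (u + 1) ^ B u else 1 := by
  by_cases hu : u + 1 < n
  · rw [if_pos hu, Finset.prod_eq_single (u + 1)]
    · rw [if_pos (by omega), if_pos rfl]
    · intro v _ hv; split_ifs <;> simp_all
    · intro hmem; exact absurd (Finset.mem_range.2 hu) hmem
  · rw [if_neg hu]
    exact Finset.prod_eq_one fun v hv => by
      rw [Finset.mem_range] at hv
      by_cases h1 : u < v
      · rw [if_pos h1, if_neg (by omega), pow_zero]
      · rw [if_neg h1]

include hy in
/-- Top sides: `∏_{u<v} tfac^{E} = ι (g^{B_top})`, `B_top t = B (t+1)`. -/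
theorem prod_top_sides (B : ℕ → ℕ) :
    (∏ u ∈ range (M + 3), ∏ v ∈ range (M + 3),
        if u < v then (if u = 0 then 1 else y (u - 1) - y (v - 1)) ^ (if v = u + 1 then B u else 0) else 1) =
      ι (monomial (gapVec M fun t => B (t + 1)) 1) := by
  have step : (∏ u ∈ range (M + 3), ∏ v ∈ range (M + 3),
        if u < v then (if u = 0 then 1 else y (u - 1) - y (v - 1)) ^ (if v = u + 1 then B u else 0) else 1) =
      ∏ u ∈ range (M + 3), (if u + 1 < M + 3 then
        (if u = 0 then (1 : K) else y (u - 1) - y (u + 1 - 1)) ^ B u else 1) :=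
    Finset.prod_congr rfl fun u _ =>
      prod_sides_inner (fun u v => if u = 0 then (1 : K) else
        y (u - 1) - y (v - 1)) B (M + 3) u
  rw [step, Finset.prod_range_succ', if_pos (show 0 + 1 < M + 3 by omega), if_pos rfl, one_pow, mul_one,
    Finset.prod_range_succ, if_neg (show ¬ (M + 1 + 1 + 1 < M + 3) by omega), mul_one]
  rw [monomial_eq, C_1, one_mul, Finsupp.prod_fintype _ _ (fun i => by simp), map_prod, ← Fin.prod_univ_eq_prod_range]
  refine Finset.prod_congr rfl fun t _ => ?_
  rw [if_pos (by omega), if_neg (by omega), map_pow, show t.val + 1 - 1 = t.val from rfl,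
    show t.val + 1 + 1 - 1 = t.val + 1 from rfl]
  have e1 : y t.val - y (t.val + 1) = ι (X t) := by
    rw [hy, hy, ← map_sub, spanPoly_anchor_succ t, add_sub_cancel_right]
  have e2 : (gapVec M fun t => B (t + 1)) t = B (t.val + 1) := by simp [gapVec]
  rw [e1, e2]

include hh in
/-- Bottom sides: `∏_{u<v} bfac^{E} = ∏_s h_s^{B s}`. -/
theorem prod_bot_sides (B : ℕ → ℕ) :
    (∏ u ∈ range (M + 3), ∏ v ∈ range (M + 3),
        if u < v then (if v = M + 2 then 1 else z u - z v) ^ (if v = u + 1 then B u else 0) else 1) =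
      ∏ s : Fin (M + 1), h s ^ B s.val := by
  have step : (∏ u ∈ range (M + 3), ∏ v ∈ range (M + 3),
        if u < v then (if v = M + 2 then 1 else z u - z v) ^ (if v = u + 1 then B u else 0) else 1) =
      ∏ u ∈ range (M + 3), (if u + 1 < M + 3 then
        (if u + 1 = M + 2 then (1 : K) else z u - z (u + 1)) ^ B u else 1) :=
    Finset.prod_congr rfl fun u _ =>
      prod_sides_inner (fun u v => if v = M + 2 then (1 : K) else
        z u - z v) B (M + 3) u
  rw [step, Finset.prod_range_succ, if_neg (lt_irrefl _), mul_one, Finset.prod_range_succ,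
    if_pos (show M + 1 + 1 < M + 3 by omega), if_pos rfl, one_pow, mul_one, ← Fin.prod_univ_eq_prod_range]
  refine Finset.prod_congr rfl fun s _ => ?_
  rw [if_pos (by omega), if_neg (by omega), hh]

/-- The total side multiplicity at an inner vertex: `B (u−1) + B u`. -/
theorem deg_sides (B : ℕ → ℕ) (u : ℕ) (hu1 : 1 ≤ u) (hu2 : u ≤ M + 1) :
    (∑ v ∈ range (M + 3), if u < v then (if v = u + 1 then B u else 0)
      else if v < u then (if u = v + 1 then B v else 0) else 0) = B (u - 1) + B u := by
  rw [Finset.sum_eq_add_of_mem (u - 1) (u + 1) (Finset.mem_range.2 (by omega)) (Finset.mem_range.2 (by omega))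
    (by omega)]
  · rw [if_neg (by omega), if_pos (by omega), if_pos (by omega), if_pos (by omega), if_pos rfl]
  · intro v _ hv
    rcases hv with ⟨h1, h2⟩
    by_cases huv : u < v
    · rw [if_pos huv, if_neg (by omega)]
    · rw [if_neg huv]
      by_cases hvu : v < u
      · rw [if_pos hvu, if_neg (by omega)]
      · rw [if_neg hvu]

include hy hι hz0 hz hh in
/-- **The exchange identity in `K`**: `ι(endProd_top) · ∏_s h_s^{B s} = aeval h (endProd_bot) · ι(g^{B_top})` under
balance at the points `1, …, M+1`. -/
theorem ι_top_mul_eq (A : ℕ → ℕ → ℕ) (B : ℕ → ℕ)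
    (hbal : ∀ u, 1 ≤ u → u ≤ M + 1 →
      (∑ v ∈ range (M + 3), if u < v then A u v else if v < u then A v u else 0) = B (u - 1) + B u) :
    ι (endProd M fun i j => A (i + 1) (j + 1)) *
        ∏ s : Fin (M + 1), h s ^ B s.val =
      MvPolynomial.aeval h (endProd M A) *
        ι (monomial (gapVec M fun t => B (t + 1)) 1) := by
  rw [← prod_top_chords ι y hy A, ← prod_bot_chords z h hh A, ← prod_top_sides ι y hy B, ← prod_bot_sides z h hh B]
  refine (prod_pairs_exchange (M + 3) _ _ (fun u => if u = 0 ∨ u = M + 2 then 1 else (y (u - 1))⁻¹)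
    A (fun u v => if v = u + 1 then B u else 0) (fun u v huv hv => factor_relation ι hι y z hy hz0 hz u v huv hv) ?_).symm
  intro u hu
  by_cases h0 : u = 0 ∨ u = M + 2
  · left; rw [if_pos h0]
  · right
    rw [hbal u (by omega) (by omega), deg_sides B u (by omega) (by omega)]

end Exchange

end GapRegime

end Summit.KontsevichZagierPeriods.Zeta5Search.Families.Cellular
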